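import Summits.PneNP.PneNP.Theses.RootDecompParityCell
import Literature.Computability.Complexity.ParityClosure

/-! # Root decomposition N10 (ParityCell) — exactness of the parity notch of the hub residual

Closes the record aside stmt-PneNP-33244 `ParityCellIff` of route `route-PneNP-RootDecompParityCell` rev 5
(decomp-pnenp cell; lens-4 g15 «CountingSandwich g15 — the parity notch of the catch coordinate of the hub
residual K», kernel `parityCellIff_holds`, critic NODE-VERDICT 2026-08-30T12:45:15Z CLEARED; writer g9 landing
certificate `N10g15_landing-g9.lean` 7da238ce):
`ParityOfCounting → ((NP ⊆ P → PP ⊆ P) ↔ ParityLift ∧ ParityCatch)` — the hub residual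
`K = RootDecompSpaceCeiling.CollapseLift` (stmt-PneNP-23703, inlined) splits EXACTLY along the ⊕P notch, modulo
the route's binder `ParityOfCounting` (stmt-PneNP-27753, Toda's relativizing containment) for `K → ParityLift`
only; `K → ParityCatch` uses the tree theorem `ParityClosure.P_subset_ParityP`; the converse is transitivity.

[cite: Toda1991SIAM, §4] [cite: BeigelMaciel1999] [cite: AaronsonIngramKretschmer2022, §6.1]
Standard axioms only.
-/

namespace Summit.PneNP.PneNP.Theorems

open Literature.Computability.Complexity

/-- EXACTNESS of the parity notch on the hub residual `K` (stmt-PneNP-23703):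
`ParityOfCounting → ((NP ⊆ P → PP ⊆ P) ↔ ParityLift ∧ ParityCatch)`. Closes stmt-PneNP-33244. -/
theorem parityCellIff_proof : Summit.PneNP.PneNP.Theses.RootDecompParityCell.ParityCellIff := by
  unfold Summit.PneNP.PneNP.Theses.RootDecompParityCell.ParityCellIff
    Summit.PneNP.PneNP.Theses.RootDecompParityCell.ParityOfCounting
    Summit.PneNP.PneNP.Theses.RootDecompParityCell.ParityLift
    Summit.PneNP.PneNP.Theses.RootDecompParityCell.ParityCatch
  intro hToda
  constructor
  · intro hK
    exact ⟨fun hNP => hToda (hK hNP), fun hNP => (hK hNP).trans ParityClosure.P_subset_ParityP⟩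
  · rintro ⟨hL, hC⟩
    exact fun hNP => (hC hNP).trans (hL hNP)

end Summit.PneNP.PneNP.Theorems
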